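import Summits.HodgeConjecture.HodgeConjecture.Theses.HeckePrymWeil

/-!
# `WeilTwelvefoldsSqrtMinus7` (stmt-HodgeConjecture-1261) · Negative · the typing device for EVERY rung

Companion to `Negative/EigenvalueTyping.lean` (same crux; refuter-cdisprove-stmt-HodgeConjecture-1261-0,
cycle 1, 2026-08-16).  There the single-operator separation `(1+i√7)^n ≠ (1-i√7)^n` was proved 2-adically
for `p = 7` only.  Here it is proved for EVERY `d ≥ 4` and every exponent `n ≥ 1` from Mathlib's Niven
theorem: if `(1+i√d)^n = (1-i√d)^n` then `μ = (1-i√d)/(1+i√d)` is an `n`-th root of unity, so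
`μ = exp(2πi·k/n)` (`Complex.mem_rootsOfUnity`) and `cos(2πk/n) = Re μ = (1-d)/(1+d)` is rational, whence
(`niven`) `(1-d)/(1+d) ∈ {-1, -1/2, 0, 1/2, 1}`, i.e. `d ∈ {∞, 3, 1, 1/3, 0}` — impossible for `d ≥ 4`.
(The excluded `d = 1, 3` genuinely fail: `typing_fails_gauss`, `typing_fails_sqrt3` in the companion file.)

Consequences recorded for the whole `HeckePrymWeil` ladder (target `HodgeWeilLadder` 1259: all primes
`p ≡ 3 (4)`, `p ≥ 7`, all `n`; cruxes 1260/1261 at `p = 7`, 1262 at `p = 11`; `WeilDescending` 1263):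

* `one_add_I_sqrt_pow_ne` : `4 ≤ d → 1 ≤ n → (1+i√d)^n ≠ (1-i√d)^n`;
* `mixed_eq_plus_iff_of_four_le`, `mixed_eq_minus_iff_of_four_le` : for `d ≥ 4` the mixed eigenvalue
  `(1+i√d)^a (1-i√d)^b` of `∧^aV_σ ⊗ ∧^bV_σ̄` under `(𝟙+φ)^*` (`φ∘φ = -d`) equals `(1+i√d)^{a+b}` iff
  `b = 0` (resp. `(1-i√d)^{a+b}` iff `a = 0`): the typed eigenspaces of every rung are exactly the Weil
  plane `∧^{2n}V_σ ⊕ ∧^{2n}V_σ̄` (granted `H^{2n}(A) = ∧^{2n}H¹(A)`);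
* `ladder_weilEigenvalues_ne` : the two typed eigenvalues `(1 ± i√p)^{2n}` of rung `(p, n)` differ for
  `7 ≤ p`, `1 ≤ n` (the `λ ≠ λ̄` inversion step of `WeilDescending`);
* `weilEigenvalues_ten_sqrt11_ne` : the instance of crux `WeilTenfoldsSqrtMinus11` (1262).
-/

noncomputable section

open Complex

namespace Summit.HodgeConjecture.HodgeConjecture.Theorems.WeilTwelvefoldsSqrtMinus7.Negative

/-- **Single-operator eigenvalue separation for every `d ≥ 4` and every exponent** (Niven):
`(1+i√d)^n ≠ (1-i√d)^n` for `n ≥ 1`.  [folklore] -/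
theorem one_add_I_sqrt_pow_ne (d : ℕ) (hd : 4 ≤ d) (n : ℕ) (hn : 1 ≤ n) :
    (1 + I * ((Real.sqrt (d : ℝ) : ℝ) : ℂ)) ^ n ≠ (1 - I * ((Real.sqrt (d : ℝ) : ℝ) : ℂ)) ^ n := by
  set s : ℂ := ((Real.sqrt (d : ℝ) : ℝ) : ℂ) with hs
  have ha : (1 + I * s) ≠ 0 := by
    intro h; have := congrArg Complex.re h; simp [hs] at this
  intro h
  -- `μ := (1 - i√d)/(1 + i√d)` is an `n`-th root of unity
  set μ : ℂ := (1 - I * s) / (1 + I * s) with hμ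
  have hμn : μ ^ n = 1 := by
    rw [hμ, div_pow, ← h, div_self (pow_ne_zero _ ha)]
  have hμ0 : μ ≠ 0 := by
    intro h0; rw [h0, zero_pow (by omega)] at hμn; exact zero_ne_one hμn
  haveI : NeZero n := ⟨by omega⟩
  let u : ℂˣ := Units.mk0 μ hμ0
  have hu : u ∈ rootsOfUnity n ℂ := by
    rw [_root_.mem_rootsOfUnity]; ext; simp [u, hμn]
  obtain ⟨i, -, hexp⟩ := (Complex.mem_rootsOfUnity n u).1 hu
  have hexpμ : Complex.exp (2 * Real.pi * I * (i / n)) = μ := by simpa [u] using hexp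
  -- its real part is the rational number `(1 - d)/(1 + d)`
  have hre : μ.re = (1 - (d : ℝ)) / (1 + d) := by
    rw [hμ, Complex.div_re, Complex.normSq_apply]
    simp [hs]
    have h7 : Real.sqrt (d : ℝ) * Real.sqrt d = d := Real.mul_self_sqrt (Nat.cast_nonneg _)
    field_simp
    nlinarith [h7]
  -- … and the cosine of a rational multiple of `π`
  have hθ : (Complex.exp (2 * Real.pi * I * (i / n))).re = Real.cos ((2 * i / n : ℝ) * Real.pi) := by
    have : (2 * Real.pi * I * (i / n) : ℂ) = ((2 * i / n : ℝ) * Real.pi : ℝ) * I := by push_cast; ring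
    rw [this, Complex.exp_ofReal_mul_I_re]
  have hcos : Real.cos ((2 * i / n : ℝ) * Real.pi) = (1 - (d : ℝ)) / (1 + d) := by
    rw [← hθ, hexpμ, hre]
  -- Niven: the only rational values of `cos` at rational multiples of `π` are `0, ±1/2, ±1`
  have hniv := niven (θ := (2 * i / n : ℝ) * Real.pi) ⟨(2 * i / n : ℚ), by push_cast; ring⟩
    ⟨((1 - d) / (1 + d) : ℚ), by rw [hcos]; push_cast; ring⟩
  rw [hcos] at hniv
  simp only [Set.mem_insert_iff, Set.mem_singleton_iff] at hniv
  have hd' : (4 : ℝ) ≤ d := by exact_mod_cast hd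
  have hpos : (0 : ℝ) < 1 + d := by linarith
  rcases hniv with h1 | h1 | h1 | h1 | h1 <;> rw [div_eq_iff hpos.ne'] at h1 <;> linarith

/-- `1 + i√d ≠ 0`. [folklore] -/
theorem one_add_I_sqrt_ne_zero (d : ℕ) : (1 + I * ((Real.sqrt (d : ℝ) : ℝ) : ℂ)) ≠ 0 := by
  intro h
  have := congrArg Complex.re h
  simp at this

/-- `1 - i√d ≠ 0`. [folklore] -/
theorem one_sub_I_sqrt_ne_zero (d : ℕ) : (1 - I * ((Real.sqrt (d : ℝ) : ℝ) : ℂ)) ≠ 0 := by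
  intro h
  have := congrArg Complex.re h
  simp at this

/-- **No mixed eigenvalue reaches the `σ`-Weil eigenvalue, every `d ≥ 4`**:
`(1+i√d)^a (1-i√d)^b = (1+i√d)^{a+b} ↔ b = 0`. [folklore] -/
theorem mixed_eq_plus_iff_of_four_le (d : ℕ) (hd : 4 ≤ d) (a b : ℕ) :
    (1 + I * ((Real.sqrt (d : ℝ) : ℝ) : ℂ)) ^ a * (1 - I * ((Real.sqrt (d : ℝ) : ℝ) : ℂ)) ^ b =
        (1 + I * ((Real.sqrt (d : ℝ) : ℝ) : ℂ)) ^ (a + b) ↔ b = 0 := by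
  refine ⟨fun h => ?_, fun h => by subst h; simp⟩
  by_contra hb
  rw [pow_add] at h
  exact one_add_I_sqrt_pow_ne d hd b (Nat.one_le_iff_ne_zero.2 hb)
    (mul_left_cancel₀ (pow_ne_zero a (one_add_I_sqrt_ne_zero d)) h).symm

/-- Mirror: `(1+i√d)^a (1-i√d)^b = (1-i√d)^{a+b} ↔ a = 0`, every `d ≥ 4`. [folklore] -/
theorem mixed_eq_minus_iff_of_four_le (d : ℕ) (hd : 4 ≤ d) (a b : ℕ) :
    (1 + I * ((Real.sqrt (d : ℝ) : ℝ) : ℂ)) ^ a * (1 - I * ((Real.sqrt (d : ℝ) : ℝ) : ℂ)) ^ b =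
        (1 - I * ((Real.sqrt (d : ℝ) : ℝ) : ℂ)) ^ (a + b) ↔ a = 0 := by
  refine ⟨fun h => ?_, fun h => by subst h; simp⟩
  by_contra ha
  rw [pow_add] at h
  exact one_add_I_sqrt_pow_ne d hd a (Nat.one_le_iff_ne_zero.2 ha)
    (mul_right_cancel₀ (pow_ne_zero b (one_sub_I_sqrt_ne_zero d)) h)

/-- **Every rung of `HodgeWeilLadder` is honestly typed**: for `7 ≤ p` and `1 ≤ n` the two eigenvalues
`(1 ± i√p)^{2n}` of `(𝟙+φ)^*` on the Weil plane differ (so `Eig(λ) ⊔ Eig(λ̄)` is direct and `(𝟙+φ)^*`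
separates `w₊` from `w₋` — the inversion step of `WeilDescending`). [folklore] -/
theorem ladder_weilEigenvalues_ne (p : ℕ) (hp : 7 ≤ p) (n : ℕ) (hn : 1 ≤ n) :
    (1 + I * ((Real.sqrt (p : ℝ) : ℝ) : ℂ)) ^ (2 * n) ≠ (1 - I * ((Real.sqrt (p : ℝ) : ℝ) : ℂ)) ^ (2 * n) :=
  one_add_I_sqrt_pow_ne p (by omega) (2 * n) (by omega)

/-- The instance of crux `WeilTenfoldsSqrtMinus11` (stmt-HodgeConjecture-1262, rung `(11, 2)`, `2n = 10`):
`(1+i√11)^10 ≠ (1-i√11)^10`. [folklore] -/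
theorem weilEigenvalues_ten_sqrt11_ne :
    (1 + I * ((Real.sqrt (11 : ℝ) : ℝ) : ℂ)) ^ 10 ≠ (1 - I * ((Real.sqrt (11 : ℝ) : ℝ) : ℂ)) ^ 10 := by
  have h := one_add_I_sqrt_pow_ne 11 (by norm_num) 10 (by norm_num)
  simpa using h

end Summit.HodgeConjecture.HodgeConjecture.Theorems.WeilTwelvefoldsSqrtMinus7.Negative

end
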